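import Mathlib
import Summits.NavierStokesRegularity.FluidComputer.AbcClassIIBasis
import Summits.NavierStokesRegularity.FluidComputer.AbcLatticePairingDomain
import Summits.NavierStokesRegularity.FluidComputer.AbcLatticeLocality
import Summits.NavierStokesRegularity.FluidComputer.AbcLinearisedLattice
import Summits.NavierStokesRegularity.FluidComputer.SkewCutGalerkinLattice

/-!
# Class-II layer of the skew-cut X0 chain, Part I: the first-order matrix in the orbit basis
(instab4 g6 — implementation 2 of the skew-cut X0 certifier, cell `ns-blowup`, 2026-08-26)

HONEST FRAMING (human ruling D-0035): nothing here is a claim about Navier–Stokes blow-up.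
WHAT THIS IS NOT: not NS evidence. MODEL lane. Sequel of `AbcClassIIDefs/Orbits/Symmetry/Basis`:
the INDEX-LEVEL inputs of `SkewCutGalerkinFromSectionsIcc.exists_smooth_eigenvector_Icc_of_sections`
for the real matrix `amat i j = Re Σ_{k∈O_i} ⟪bfam i k, Π_k X(bfam j)(k)⟫` of the certifiers'
first-order part in the orbit-adapted basis:

* `amat_eq` — (E1) the matrix IS the complex pairing (reality by conjugate symmetry);
* `amat_eq_zero_of_not_mem` — (E2) BAND: `amat i j = 0` off `nbrIdx i` (`AbcLatticeLocality`);
* `norm_lerayCrossForm_le` / `abs_amat_le` — (E3) first-order GROWTH `|amat i j| ≤ 2592 √(1+|O_j|²)`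
  (`Π[N+N] = −2π ΠX`, Leray contraction, instab3's `norm_linSym_abcFlow_le`);
* `card_nbrIdx_le` (W = 288²), `one_add_onormSq_le_of_mem_nbrIdx` (band-comparable levels, instab3's
  `one_add_levels_le_of_neighbour`), `tendsto_levels` ((A1), instab3's `tendsto_levels_atBot`).

Mathlib + the files named; no new definitions.
-/

noncomputable section

open scoped BigOperators ComplexConjugate InnerProductSpace
open Finset MeasureTheory UnitAddTorus

namespace Summit.NavierStokesRegularity.FluidComputer.AbcClassII

open Literature.Analysis.FunctionSpaces Literature.Analysis.FunctionSpaces.Torus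
open Literature.Analysis.FunctionSpaces.EuclideanSpace
open Literature.Analysis.FluidPDE Literature.Analysis.FluidPDE.SteadyLattice
open Literature.Analysis.FluidPDE.ScalarFourier

/-! ## Part I. Index-level data of the abstract chain: the real matrix `amat`, band, growth, levels (instab4 g6) -/

section Index

/-- `Π_k 0 = 0`. -/
theorem lerayCoeff_zero_vec (k : Fin 3 → ℤ) : Torus.lerayCoeff k (0 : EuclideanSpace ℂ (Fin 3)) = 0 := by
  have h := lerayCoeff_smul' k (0 : ℂ) (0 : EuclideanSpace ℂ (Fin 3))
  rw [zero_smul, zero_smul] at h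
  exact h

/-- **(E1) The real matrix IS the complex pairing**: `amat i j = Σ_{k ∈ O_i} ⟪bfam i k, Π_k X(bfam j)(k)⟫`. -/
theorem amat_eq (i j : Idx) : ((amat i j : ℝ) : ℂ) =
    ∑ k ∈ i.1.1, (inner ℂ (bfam i k) (Torus.lerayCoeff k (crossForm 1 1 1 (bfam j) k)) : ℂ) := by
  rw [amat]
  exact (sum_inner_eq_re_of_isConjSymm (bfam_spec i).2.2 (isConjSymm_lerayCrossForm (bfam_spec j).2.2)
    (neg_mem_of_orbitClosed i.1.orbitClosed)).symm

/-- `Π_k X(bfam j)(k) = 0` unless some `k − s`, `s ∈ {±e_m}`, lies in the orbit of `j` (locality). -/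
theorem lerayCrossForm_bfam_eq_zero {j : Idx} {k : Fin 3 → ℤ} (hk : ∀ s ∈ Torus.abcFreq, k - s ∉ j.1.1) :
    Torus.lerayCoeff k (crossForm 1 1 1 (bfam j) k) = 0 := by
  have h : crossForm 1 1 1 (bfam j) k = 0 :=
    AbcLatticeLocality.crossForm_eq_zero_of_neighbours 1 1 1 (bfam j) k
      fun s hs => bfam_apply_of_not_mem j (hk s hs)
  rw [h, lerayCoeff_zero_vec]

/-- **(E2) The matrix is banded**: `amat i j = 0` unless `j ∈ nbrIdx i`. -/
theorem amat_eq_zero_of_not_mem {i j : Idx} (h : j ∉ nbrIdx i) : amat i j = 0 := by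
  have h' : ∀ k ∈ i.1.1, ∀ s ∈ Torus.abcFreq, k - s ∉ j.1.1 := by
    intro k hk s hs hks
    exact h (mem_nbrIdx.mpr (mem_nbrOrbits.mpr ⟨k, hk, s, hs, hks⟩))
  rw [amat, Finset.sum_eq_zero fun k hk => by rw [lerayCrossForm_bfam_eq_zero (h' k hk), inner_zero_right]]
  simp

/-- `Σ_{k ∈ O_i} ‖bfam i k‖² = 1`. -/
theorem sum_norm_sq_bfam (i : Idx) : ∑ k ∈ i.1.1, ‖bfam i k‖ ^ 2 = 1 := by
  have h := sum_inner_bfam (i := i) le_rfl i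
  rw [if_pos rfl] at h
  have h' : ∑ k ∈ i.1.1, (inner ℂ (bfam i k) (bfam i k) : ℂ) = ∑ k ∈ i.1.1, (((‖bfam i k‖ ^ 2 : ℝ)) : ℂ) :=
    Finset.sum_congr rfl fun k _ => by rw [inner_self_eq_norm_sq_to_K]; push_cast; rfl
  rw [h', ← Complex.ofReal_sum] at h
  exact_mod_cast h

/-- `‖bfam i k‖ ≤ 1`. -/
theorem norm_bfam_le_one (i : Idx) (k : Fin 3 → ℤ) : ‖bfam i k‖ ≤ 1 := by
  by_cases hk : k ∈ i.1.1
  · have h1 : ‖bfam i k‖ ^ 2 ≤ 1 := by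
      rw [← sum_norm_sq_bfam i]
      exact Finset.single_le_sum (f := fun k => ‖bfam i k‖ ^ 2) (fun _ _ => sq_nonneg _) hk
    nlinarith [norm_nonneg (bfam i k)]
  · rw [bfam_apply_of_not_mem i hk, norm_zero]; exact zero_le_one

/-- **Pointwise first-order bound of the projected symbol**:
`‖Π_k X c(k)‖ ≤ 9 Σ_y ⟨k − q_y⟩ ‖c(k − q_y)‖` (`Π[N+N] = −2π ΠX`, Leray contraction, instab3's
`norm_linSym_abcFlow_le`, `‖Û(±e_j)‖ ≤ 1`). -/
theorem norm_lerayCrossForm_le (c : Fam) (k : Fin 3 → ℤ) :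
    ‖Torus.lerayCoeff k (crossForm 1 1 1 c k)‖ ≤
      9 * ∑ y : Fin 3 × Bool, sobolevWeight 1 (k - Torus.abcDir y) * ‖c (k - Torus.abcDir y)‖ := by
  have hid := AbcLatticeEigenSynthesis.lerayCoeff_linSym_abcFlow 1 1 1 c k
  have hNN := AbcLinearisedLattice.norm_linSym_abcFlow_le 1 1 1 c k
  have hP := (norm_lerayCoeff_le k _).trans hNN
  rw [hid] at hP
  change ‖(-(2 * Real.pi : ℂ)) • Torus.lerayCoeff k (crossForm 1 1 1 c k)‖ ≤ _ at hP
  rw [norm_smul, norm_neg] at hP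
  have h2π : ‖(2 * Real.pi : ℂ)‖ = 2 * Real.pi := by
    rw [show (2 * Real.pi : ℂ) = ((2 * Real.pi : ℝ) : ℂ) by push_cast; ring, Complex.norm_real,
      Real.norm_eq_abs, abs_of_pos (by positivity)]
  rw [h2π] at hP
  have hπ : 0 < Real.pi := Real.pi_pos
  -- `‖Û‖ ≤ 1` termwise
  have hS : ∑ y : Fin 3 × Bool, ‖Torus.abcCoeff 1 1 1 (Torus.abcDir y)‖ *
      sobolevWeight 1 (k - Torus.abcDir y) * ‖c (k - Torus.abcDir y)‖ ≤
      ∑ y : Fin 3 × Bool, sobolevWeight 1 (k - Torus.abcDir y) * ‖c (k - Torus.abcDir y)‖ := by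
    refine Finset.sum_le_sum fun y _ => ?_
    have h0 : 0 ≤ sobolevWeight 1 (k - Torus.abcDir y) * ‖c (k - Torus.abcDir y)‖ :=
      mul_nonneg (sobolevWeight_pos 1 _).le (norm_nonneg _)
    calc ‖Torus.abcCoeff 1 1 1 (Torus.abcDir y)‖ * sobolevWeight 1 (k - Torus.abcDir y) * ‖c (k - Torus.abcDir y)‖
        = ‖Torus.abcCoeff 1 1 1 (Torus.abcDir y)‖ * (sobolevWeight 1 (k - Torus.abcDir y) * ‖c (k - Torus.abcDir y)‖) := by ring
      _ ≤ 1 * (sobolevWeight 1 (k - Torus.abcDir y) * ‖c (k - Torus.abcDir y)‖) :=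
          mul_le_mul_of_nonneg_right (AbcLatticePairingDomain.norm_abcCoeff_one_le y) h0
      _ = _ := one_mul _
  nlinarith [hS, hP, norm_nonneg (Torus.lerayCoeff k (crossForm 1 1 1 c k))]

/-- `⟨m⟩ = √(1 + |m|²)`. -/
theorem sobolevWeight_one_eq (m : Fin 3 → ℤ) : sobolevWeight 1 m = Real.sqrt (1 + freqNormSq m) := by
  rw [sobolevWeight, Real.sqrt_eq_rpow]

/-- **Growth on a basis family**: `‖Π_k X(bfam j)(k)‖ ≤ 54 √(1 + |O_j|²)`. -/
theorem norm_lerayCrossForm_bfam_le (j : Idx) (k : Fin 3 → ℤ) :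
    ‖Torus.lerayCoeff k (crossForm 1 1 1 (bfam j) k)‖ ≤ 54 * Real.sqrt (1 + onormSq j.1) := by
  refine (norm_lerayCrossForm_le (bfam j) k).trans ?_
  have hterm : ∀ y : Fin 3 × Bool, sobolevWeight 1 (k - Torus.abcDir y) * ‖bfam j (k - Torus.abcDir y)‖ ≤
      Real.sqrt (1 + onormSq j.1) := by
    intro y
    by_cases hm : k - Torus.abcDir y ∈ j.1.1
    · rw [sobolevWeight_one_eq, j.1.freqNormSq_eq hm]
      calc Real.sqrt (1 + onormSq j.1) * ‖bfam j (k - Torus.abcDir y)‖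
          ≤ Real.sqrt (1 + onormSq j.1) * 1 :=
            mul_le_mul_of_nonneg_left (norm_bfam_le_one j _) (Real.sqrt_nonneg _)
        _ = _ := mul_one _
    · rw [bfam_apply_of_not_mem j hm, norm_zero, mul_zero]; exact Real.sqrt_nonneg _
  have hsum : ∑ y : Fin 3 × Bool, sobolevWeight 1 (k - Torus.abcDir y) * ‖bfam j (k - Torus.abcDir y)‖ ≤
      6 * Real.sqrt (1 + onormSq j.1) := by
    calc ∑ y : Fin 3 × Bool, sobolevWeight 1 (k - Torus.abcDir y) * ‖bfam j (k - Torus.abcDir y)‖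
        ≤ ∑ _y : Fin 3 × Bool, Real.sqrt (1 + onormSq j.1) := Finset.sum_le_sum fun y _ => hterm y
      _ = 6 * Real.sqrt (1 + onormSq j.1) := by simp
  linarith

/-- **(E3) First-order growth of the matrix**: `|amat i j| ≤ 2592 √(1 + |O_j|²)`. -/
theorem abs_amat_le (i j : Idx) : |amat i j| ≤ 2592 * Real.sqrt (1 + onormSq j.1) := by
  rw [amat]
  refine (Complex.abs_re_le_norm _).trans ((norm_sum_le _ _).trans ?_)
  have hterm : ∀ k ∈ i.1.1, ‖(inner ℂ (bfam i k) (Torus.lerayCoeff k (crossForm 1 1 1 (bfam j) k)) : ℂ)‖ ≤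
      54 * Real.sqrt (1 + onormSq j.1) := by
    intro k _
    refine (norm_inner_le_norm _ _).trans ?_
    calc ‖bfam i k‖ * ‖Torus.lerayCoeff k (crossForm 1 1 1 (bfam j) k)‖
        ≤ 1 * (54 * Real.sqrt (1 + onormSq j.1)) :=
          mul_le_mul (norm_bfam_le_one i k) (norm_lerayCrossForm_bfam_le j k) (norm_nonneg _) zero_le_one
      _ = _ := one_mul _
  calc ∑ k ∈ i.1.1, ‖(inner ℂ (bfam i k) (Torus.lerayCoeff k (crossForm 1 1 1 (bfam j) k)) : ℂ)‖
      ≤ ∑ _k ∈ i.1.1, 54 * Real.sqrt (1 + onormSq j.1) := Finset.sum_le_sum hterm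
    _ = i.1.1.card * (54 * Real.sqrt (1 + onormSq j.1)) := by rw [Finset.sum_const, nsmul_eq_mul]
    _ ≤ 48 * (54 * Real.sqrt (1 + onormSq j.1)) := by
        have h48 : (i.1.1.card : ℝ) ≤ 48 := by exact_mod_cast i.1.card_le
        exact mul_le_mul_of_nonneg_right h48 (by positivity)
    _ = 2592 * Real.sqrt (1 + onormSq j.1) := by ring

/-- **Band width**: `card (nbrIdx i) ≤ 288 · 288`. -/
theorem card_nbrIdx_le (i : Idx) : (nbrIdx i).card ≤ 288 * 288 := by
  obtain ⟨O, a⟩ := i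
  show ((nbrOrbits O).sigma fun O' => (Finset.univ : Finset (Fin (odim O')))).card ≤ 288 * 288
  rw [Finset.card_sigma]
  calc ∑ O' ∈ nbrOrbits O, (Finset.univ : Finset (Fin (odim O'))).card
      ≤ ∑ _O' ∈ nbrOrbits O, 288 := Finset.sum_le_sum fun O' _ => by rw [Finset.card_fin]; exact odim_le O'
    _ = (nbrOrbits O).card * 288 := by rw [Finset.sum_const, smul_eq_mul]
    _ ≤ 288 * 288 := Nat.mul_le_mul_right _ (card_nbrOrbits_le O)

/-- **Neighbouring orbits have comparable levels**: for `j ∈ nbrIdx i`,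
`1 + |O_i|²/R ≤ 2(1 + 1/R)(1 + |O_j|²/R)` (instab3's `one_add_levels_le_of_neighbour`). -/
theorem one_add_onormSq_le_of_mem_nbrIdx {R : ℝ} (hR : 0 < R) {i j : Idx} (h : j ∈ nbrIdx i) :
    1 + onormSq i.1 / R ≤ 2 * (1 + R⁻¹) * (1 + onormSq j.1 / R) := by
  obtain ⟨k, hk, s, hs, hks⟩ := mem_nbrOrbits.mp (mem_nbrIdx.mp h)
  have hq : ∑ m, (((k m : ℤ) : ℝ) - (((k - s) m : ℤ) : ℝ)) ^ 2 ≤ 1 := by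
    obtain ⟨y, rfl⟩ := Torus.mem_abcFreq.mp hs
    have e : ∀ m, (((k m : ℤ) : ℝ) - (((k - Torus.abcDir y) m : ℤ) : ℝ)) = ((Torus.abcDir y m : ℤ) : ℝ) := by
      intro m; simp
    simp_rw [e]
    have := Torus.freqNormSq_abcDir y
    rw [freqNormSq] at this
    exact this.le
  have h1 := SkewCutGalerkinLattice.one_add_levels_le_of_neighbour (inv_nonneg.mpr hR.le) k (k - s) hq
  rw [← i.1.freqNormSq_eq hk, ← j.1.freqNormSq_eq hks, freqNormSq, freqNormSq, div_eq_inv_mul, div_eq_inv_mul]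
  exact h1

/-- The section index sets contain the representative fibres: `{i : ∀ m, |rep_i m| ≤ n} ⊆ cubeIdx n`;
in particular these fibres are finite. -/
theorem finite_rep_fibre (n : ℕ) : Set.Finite {i : Idx | ∀ m, |i.1.rep m| ≤ (n : ℤ)} := by
  refine (cubeIdx n).finite_toSet.subset fun i hi => ?_
  simp only [Set.mem_setOf_eq] at hi
  rw [Finset.mem_coe, mem_cubeIdx, ← i.1.supNorm_eq i.1.rep_mem]
  exact mem_cube_iff_supNorm.mp (mem_cube.mpr hi)

/-- **(A1) The levels `−|O_i|²/R` tend to `−∞` cofinitely** (instab3's `tendsto_levels_atBot`). -/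
theorem tendsto_levels {R : ℝ} (hR : 0 < R) :
    Filter.Tendsto (fun i : Idx => -(onormSq i.1 / R)) Filter.cofinite Filter.atBot := by
  have h := SkewCutGalerkinLattice.tendsto_levels_atBot (inv_pos.mpr hR) (fun i : Idx => i.1.rep) finite_rep_fibre
  refine (Filter.tendsto_congr fun i => ?_).mp h
  rw [onormSq, freqNormSq, div_eq_inv_mul]

end Index

end Summit.NavierStokesRegularity.FluidComputer.AbcClassII

end
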